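import Mathlib
import HarnessLib
import HarnessLib.Audit
import Summits.AtomisticToContinuum.Statement
import Literature.MathematicalPhysics.QuantumManyBody.PeriodicBoseGasFourier
import Literature.MathematicalPhysics.QuantumManyBody.PeriodicBoseGasLocalization

/-!
Route: BECSumRuleBootstrap

CLOSED (retired) 2026-08-15T13:40:49Z by operator:999:1257524 — reason: not-a-thesis: assembly does not conclude the sub-problem Statement — note: D-0027 §2.1 audit (human 2026-08-15: routes that do not decide the summit are removed): the assembly concludes `Literature.MathematicalPhysics.QuantumManyBody.BoseGas.BoseEinsteinCondensation`, not the sub-problem statement; a NEW conforming route may be opened from the same idea (generated `closes . The file is kept as the record of this route; refuted decls are indexed as negative knowledge (`ledger negatives`).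

# Route BECSumRuleBootstrap — phase quadrature from exact sum rules (m2^2 <= m1 m3 on the
longitudinal current) + c-number split + condensate-number concentration + coupling-continuity
bootstrap from the free gas

It suffices to show X = SmoothPeriodicBEC ∧ BoundaryTransferWeak ∧ HardCoreExtension, and
SmoothPeriodicBEC (constant-mode BEC for
near-minimisers of the PERIODIC N-body energy on the torus of side L = (N/ρ)^{1/3} at all small ρ,
for every finite C² finite-range
repulsive potential with the edge condition ‖D²ṽ‖ ≤ Cₑ√ṽ) is reduced by the glue item
SumRuleChainGlue to two cruxes on the
torus minimiser Ψ_t of −Σ∆ + tΣv^per, uniformly in t ∈ (0,1]: NonCondensateRemainders (the 4-point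
remainders of the c-number split of the
longitudinal current [H,ρ_k†] and of the density ρ_k† are o(N²) when summed over the infrared modes
|k| < Λ√(ρa)) and
CondensateNumberConcentration (Var N̂₀ = o(N²)), plus LongWaveStructureBound (box-number second
moments, from energy convexity) and
four fixed-N support statements. Card realised: diamagnetic-gd-bootstrap (spine; retitled per
audits: the longitudinal 'diamagnetic'
domination is B_k = N by the f-sum rule, the engine is m₂² ≤ m₁m₃). BoundaryTransferWeak is shared
verbatim with route BECPeriodicReduction;
HardCoreExtension carries the smooth class to the conjunct's full class.
Lean: `(open Literature.MathematicalPhysics.QuantumManyBody.BoseGas in ∀ v : ℝ → ENNReal,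
IsRepulsiveFiniteRange v → (∀ r, v r ≠ ⊤) → ContDiff ℝ 2 (fun x : Space => (v ‖x‖).toReal) → (∃ Cₑ :
ℝ, ∀ x : Space, ‖iteratedFDeriv ℝ 2 (fun x : Space => (v ‖x‖).toReal) x‖ ≤ Cₑ * Real.sqrt ((v
‖x‖).toReal)) → ∃ ρ₀ : ℝ, 0 < ρ₀ ∧ ∀ ρ : ℝ, 0 < ρ → ρ < ρ₀ → ∃ c : ℝ, 0 < c ∧ ∀ᶠ N : ℕ in
Filter.atTop, ∃ δ : ENNReal, 0 < δ ∧ ∀ Ψ : PeriodicTrialState N (sideLength ρ N), periodicEnergy v Ψ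
≤ periodicGroundStateEnergy v N (sideLength ρ N) + δ → ENNReal.ofReal (c * N) ≤ condensateOccupation
N (sideLength ρ N) Ψ.ψ) ∧ BoundaryTransferWeak ∧ HardCoreExtension`

## Assembly
Pure logic (checked sorry-free in Sketch.lean, theorem assembly_holds, axioms
propext/Classical.choice/Quot.sound): the seven
statements feed SumRuleChainGlue, which yields SmoothPeriodicBEC; for a class potential v its body
is exactly the hypothesis of
BoundaryTransferWeak v, giving HasGroundStateBEC v ρ for small ρ; HardCoreExtension turns the
class-restricted conclusion into the
conjunct Literature.MathematicalPhysics.QuantumManyBody.BoseGas.BoseEinsteinCondensation.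

Rationale: WHY THIS LINE. The only proofs of BEC for interacting bosons in a thermodynamic limit
(DysonLiebSimon1978, KennedyLiebShastry1988 = KLS1988PRL) run:
Gaussian domination ⇒ infrared bound ⇒ sum rule; here the domination is replaced by an EXACT
ground-state inequality of the sum-rule
school (Puff1965, Wagner1966, PitaevskiiStringari1991, Stringari1995): for the torus minimiser the
longitudinal current A_k = [H,ρ_k†]
satisfies m₂ = ‖A_kΨ₀‖² ≤ √(m₁m₃) with m₁ = N|k|² (f-sum) and m₃ = ½⟨[A_k†,[H,A_k]]⟩ ≤ N|k|⁴(|k|² +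
O(ρ)) — Bogoliubov-sharp for the
PHASE quadrature, and an UPPER bound because m₂ sits between two commutator moments (Stringari used
the same moments only for lower
bounds and the 1D no-go). The c-number split (LiebSeiringerYngvason2005) of A_k and ρ_k† gives the
exact per-mode identity
‖A_k^cΨ‖²/|k|⁴ + ‖ρ_k^{c†}Ψ‖² = 2n₀ + 2E[N̂₀(n̂_k+n̂_{−k})] + 2n_{−k}; summing over |k| < Λ√(ρa)
(mode count Λ³√(ρa³)N ≪ N), cutting the UV by
kinetic energy ≤ E₀ ≤ 8πaρN (LSSY2005 Thm 2.2, proved in tree) yields the dichotomy E[N̂₀(N−N̂₀)] ≤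
εN² — whence, and this is the planner's
correction of the card, the mean x = n₀/N obeys x(1−x) ≤ ε + Var(N̂₀)/N² and the forbidden band
needs CondensateNumberConcentration; the
band is then crossed from x(0) = 1 (free gas) by continuity in the coupling at fixed N, L
(Kato1966), converting a self-consistent estimate
into a theorem with no a-priori condensate input. Imported: sum rules/linear response (many-body
physics), Fournais2020 Thm 2.1 localized
lower bound (in tree, proved) through convexity for the long-wave number variance; no RP, no gap at
scale L, no energy asymptotics matching.
Unlike BECInfraredBound (IR bound on n(p) filed directly) or phonon-transport-fsum (same engine,
dipole transport of Palm measures), the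
residual statements here are two summed 4-point bounds and a variance, each Bogoliubov-consistent
(O(Λ³ρa³N²), O(N√(ρa³))).

RANKED CRUXES. #0 SmoothPeriodicBEC (target) — PeriodicBEC (route BECPeriodicReduction, item 0826)
restricted to the smooth class: for every repulsive finite-range v that is finite, C² as ṽ(x) =
v(|x|) on ℝ³, with ‖D²ṽ(x)‖ ≤ Cₑ√ṽ(x) (edge condition; e.g. (R₀²−|x|²)₊⁴), there is ρ₀ > 0 such that
for 0 < ρ < ρ₀ there is c > 0 with: for all large N there is δ > 0 such that every periodic trial
state on the torus of side (N/ρ)^{1/3} with periodicEnergy ≤ E₀^per + δ has constant-mode occupation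
≥ cN. (why it might fail: contains the open thermodynamic-limit BEC problem for smooth potentials
(LSSY2005 Ch. 5: open; Fournais2020/Junge2026/ChongLiangNam2026 stop at L ≲ a(ρa³)^(-3/4-η)).)
[LSSY2005, Fournais2020, Junge2026, ChongLiangNam2026]
#2 NonCondensateRemainders (crux) — (card C1, corrected & summed) for the torus minimiser Ψ of −Σ∆ⱼ
+ tΣv^per (t ∈ (0,1], L = (N/ρ)^{1/3}, ρ < ρ₀(Λ,ε), N large): Σ over 0 < |k| < Λ√(ρa), k = 2πn/L, of
‖A_k^{nc}Ψ‖²/|k|⁴ + ‖ρ_k^{nc†}Ψ‖² is ≤ εN², where A_k^{nc} = Σⱼ Qⱼ e^{ik·xⱼ}(−2ik·∇ⱼ + |k|²) Qⱼ and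
ρ_k^{nc†} = Σⱼ Qⱼ e^{ik·xⱼ} Qⱼ (Q = 1 − |φ₀⟩⟨φ₀|, written out with cell averages) are the
non-condensate parts of the longitudinal current [H,ρ_k†] and of the density. Bogoliubov: ‖A^{nc}Ψ‖²
= ½Σ_p(2p·k+k²)²(u_pv_{p+k}−v_pu_{p+k})² = O(|k|⁴N√(ρa³)), ‖ρ^{nc†}Ψ‖² =
½Σ_p(u_pv_{p+k}+v_pu_{p+k})² = O(N√(ρa³)); summed: O(Λ³ρa³N²) — no log. [difficulty: open-problem]
(why it might fail: 4-point functions of the depletion with no a-priori handle (Cauchy–Schwarz gives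
N₊·|k|²⟨T⟩, useless); smallness rests on the pair-current cancellation (u_pv_q−v_pu_q)² of
Bogoliubov's state, unproved for Ψ₀ — Gavoret–Nozières territory; a log L in R_A would already break
the ε.) [LiebSeiringerYngvason2005, Stringari1995, GavoretNozieres1964, Griffin1993,
Literature.Barriers.AtomisticToContinuum.BogoliubovPerturbationInfrared]
#3 CondensateNumberConcentration (crux) — (planner's addition; the card's bootstrap needs it) along
the coupling path the zero-mode number operator N̂₀ = ΣⱼPⱼ of the torus minimiser satisfies E[N̂₀²]
= N(N−1)‖P₁P₂Ψ‖² + n₀ ≤ n₀² + ζN² for N large, every ζ > 0, ρ < ρ₀(ζ), uniformly in t ∈ (0,1]: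
Var(N̂₀/N) → 0. With the chain's dichotomy E[N̂₀(N−N̂₀)] ≤ εN² this gives x(1−x) ≤ ε + ζ for the
mean x = n₀/N. Bogoliubov: Var N̂₀ = Σ_k 2u_k²v_k² = O(N√(ρa³)). [difficulty: XL] (why it might
fail: equivalent to excluding a macroscopic superposition of a condensed and an uncondensed branch,
i.e. a first-order transition at some t* ≤ 1 at finite N; reducible to m₁(N̂₀) = ½⟨[N̂₀,[V,N̂₀]]⟩ =
O(Nρa) plus a P=0-sector gap ≫ a/L³, and no N-uniform many-body gap bound is known.)
[doi:10.1103/physrevlett.80.5040, LiebSeiringerYngvason2005, LSSY2005,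
Literature.Barriers.AtomisticToContinuum.SymmetryBreakingWithoutCondensate]
#4 LongWaveStructureBound (crux) — long-wave number fluctuations of the torus minimiser are
relatively small: with ℓ = (K√(ρa))⁻¹ and sliding boxes Λ_u(ℓ) (periodised), L⁻³∫_cell E_Ψ[N_{Λ_u}²]
du ≤ (1+ε)(ρℓ³)² for N large, every K, ε > 0, ρ < ρ₀(K,ε), uniformly in t. By Parseval in u it gives
Σ_{0<|k|<πK√(ρa)} S(k) ≤ (π/2)⁶εN (all the static-structure input the chain needs: mode count ≪ N)
and the close-pair counts entering m₃. [difficulty: L] (why it might fail: meant to follow from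
convexity: Fournais2020 Thm 2.1 (proved) used sector-wise with box-wise chemical potential on a
K-grid vs Dyson's upper bound; if C₀(K), c(K) are not uniform on the grid or the flat-top χ boundary
layer leaks, it needs an LHY-precision upper bound.) [Fournais2020, BrietzkeFournaisSolovej2020,
LSSY2005, YauYin2009, BastiCenatiempoSchlein2021]
#5 BoundaryTransferWeak (crux) — (shared verbatim with route BECPeriodicReduction,
stmt-AtomisticToContinuum-0827) for each repulsive finite-range v, PeriodicBEC(v) implies ∃ρ₀>0
∀ρ∈(0,ρ₀) HasGroundStateBEC v ρ (Dirichlet, mode-free); expected proof: Neumann bracketing of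
interior sub-boxes + λ_max(γ) ≥ tr γ²/N. [difficulty: L] (why it might fail: PeriodicBEC(v) is
ground-state-only (δ after N); the Dirichlet GS is a periodic trial state but lies a wall term ≫ δ
above E₀^per, so no energy-comparison proof; only the ENERGY transfer is in print; BEC can be
boundary-condition sensitive.) [LSSY2005, arXiv:2203.01841, arXiv:2205.15284,
doi:10.1007/bf01608554]
#6 HardCoreExtension (crux) — ground-state BEC at all small densities for every potential of the
smooth class (finite, C², finite range, ‖D²ṽ‖ ≤ Cₑ√ṽ) implies the conjunct for every repulsive
finite-range potential (hard cores, shells, kinks included). [difficulty: XL] (why it might fail: no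
comparison or monotonicity of λ_max(γ) in v is known; approximating a hard core by class members v_n
↑ gives BEC with ρ₀(v_n), c(v_n) possibly → 0; Dyson's lemma transfers energies only (small-N
numerics of cards repulsion-monotone-hard-sphere support antitonicity of γ_v, unproved).) [LSSY2005,
Dyson1957, LiebYngvason1998]
#9 CurrentSumRule (support) — (the engine; Puff/Wagner/Stringari moments, variational form) for t ∈
(0,1], 2R₀ < L and every C³ periodic minimiser Ψ of −Σ∆ + tΣv^per with finite energy, for every k =
2πn/L ≠ 0: m₂² ≤ m₁·M₃ with m₂ = ‖Σⱼe^{ik·xⱼ}(−2ik·∇ⱼ+|k|²)Ψ‖² (= ‖[H,ρ_k†]Ψ‖²), m₁ = N|k|² (f-sum)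
and M₃ = 12|k|²Σⱼ‖(k·∇ⱼ)Ψ‖² + N|k|⁶ + 4E_Ψ[Σ_{i<j}(1−cos k·(xᵢ−xⱼ))|(k·∇)²(tṽ^per)(xᵢ−xⱼ)|] ≥ m₃ =
½⟨[A_k†,[H,A_k]]⟩. Proof: 0 ≤ q_{H−E₀}(sA_kΨ − ρ_k†Ψ) = s²m₃ − 2sm₂ + m₁ for all s > 0, using only
the weak Euler–Lagrange equation of the minimiser, inversion symmetry k ↔ −k and integration by
parts — no spectral theorem. [difficulty: M] [Puff1965, Wagner1966, Stringari1995,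
PitaevskiiStringari1991, KLS1988PRL]
#9 MinimiserRegularity (support) — for every class potential, N ≥ 1 and L > 0 the periodic N-body
energy has a minimiser in the C¹ periodic Bose-symmetric class which is C³ with finite energy
(Rellich on the torus, elliptic regularity C^{3,α} for V ∈ C², bosonic ground state = absolute
ground state, Perron–Frobenius positivity). [difficulty: L] [ReedSimonIV1978, LSSY2005]
#9 NearMinimiserStability (support) — at fixed N, L: for every ε > 0 there is δ > 0 such that every
δ-near-minimiser Φ has condensateOccupation ≥ that of a minimiser Ψ minus εN (discrete spectrum and
simple ground state by positivity improvement: ‖Φ − e^{iθ}Ψ‖² ≤ δ/gap; n₀ is 2N-Lipschitz in L²).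
[difficulty: M] [ReedSimonIV1978, LSSY2005]
#9 CouplingContinuity (support) — at fixed N, L the constant-mode occupation of the minimiser of −Σ∆
+ tΣv^per is uniformly continuous in t ∈ [0,1] (including: two minimisers at the same t have the
same n₀; at t = 0 the minimisers are the constants, n₀ = N): analytic perturbation theory of a
simple isolated eigenvalue (free torus gap (2π/L)², Perron–Frobenius for t > 0). [difficulty: L]
[Kato1966, ReedSimonIV1978]
#9 SumRuleChainGlue (support) — (glue of the foreseen split; kind glue) MinimiserRegularity →
CouplingContinuity → NearMinimiserStability → CurrentSumRule → LongWaveStructureBound →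
NonCondensateRemainders → CondensateNumberConcentration → SmoothPeriodicBEC. Bookkeeping: (i)
per-mode identity ‖A_k^cΨ‖²/|k|⁴ + ‖ρ_k^{c†}Ψ‖² = 2n₀ + 2E[N̂₀(n̂_k+n̂_{−k})] + 2n_{−k} and ‖A^c‖ ≤
‖A‖ + ‖A^{nc}‖; (ii) m₂ ≤ √(N|k|²M₃), M₃ ≤ N|k|⁴(|k|² + 48πaρ + o(1)) from Σ‖(k·∇ⱼ)Ψ‖² ≤ |k|²KE ≤
|k|²E₀(tv) ≤ |k|²E₀(v) ≤ |k|²·8πaρN (LSSY2005_upperBound_periodic_holds) and, for the potential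
part, ‖D²ṽ‖ ≤ Cₑ√ṽ + Hölder + close-pair counts from LongWaveStructureBound (O(ρ^{1/4})); (iii)
Σ_{IR}S(k) ≤ (π/2)⁶εN (Parseval in u, K = Λ/π), mode count ≤ Λ³√(ρa³)N/(6π²); (iv) UV:
Σ_{|k|≥Λ√(ρa)} n_k ≤ KE/(Λ²ρa) ≤ 8πN/Λ² (Parseval for γ with the in-tree cell Fourier toolkit); (v)
⇒ E[N̂₀(N−N̂₀)] ≤ ε₁N², with crux 3 x(1−x) ≤ ε₁ + ζ < 3/16 ⇒ x ∉ (1/4,3/4) for all t;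
CouplingContinuity, x(0) = 1 and connectedness of [0,1] ⇒ x(1) ≥ 3/4; NearMinimiserStability with ε
= 1/4 ⇒ c = 1/2. Degenerate a = 0: LSSY2005_zeroScatteringLength_holds ⇒ minimiser constant.
[difficulty: L] [Stringari1995, LSSY2005, Fournais2020, LiebSeiringerYngvason2005]

TWO-LAYER PLAN. Foreseen glued splits (k ≤ 3, depth 1), filed only after a crux moves:
NonCondensateRemainders ⇐ CurrentRemainder (Σ‖A_k^{nc}Ψ‖²/|k|⁴ ≤ εN²)
→ DensityRemainder (Σ‖ρ_k^{nc†}Ψ‖² ≤ εN²) → NonCondensateRemainders; CondensateNumberConcentration ⇐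
ZeroModeFSum (m₁(N̂₀) =
½⟨[N̂₀,[V,N̂₀]]⟩ ≤ C·aρN, provable) → ZeroMomentumSectorGap (gap of H_t in the P = 0 bosonic sector
≥ ω_N·a/L³, ω_N → ∞) →
CondensateNumberConcentration (glue: Var N̂₀ ≤ m₁/Δ₀); LongWaveStructureBound ⇐ SectorwiseBoxBound
(Fournais Thm 2.1 with a ρ_μ-grid at
fixed geometry) → SlidingBookkeeping (Lemmas 3.2/3.3 with flat-top χ, boundary-layer covering) →
LongWaveStructureBound.

KILL CRITERIA. ¬CondensateNumberConcentration (Var N̂₀ ≳ N² for torus ground states at arbitrarily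
small ρ, e.g. a first-order transition along t) closes
the route (close --reason refuted:CondensateNumberConcentration): the bootstrap has no substitute.
¬NonCondensateRemainders (e.g. Σ_IR
‖ρ^{nc†}Ψ₀‖² ≥ cN², or a log L in the current remainder) closes it as well. ¬LongWaveStructureBound
forces a pivot to the card's static
response crux (χ_{N,L}(k) ≤ C/(ρa), second-order energy with a slowly varying field) as an explicit
item. ¬HardCoreExtension does not kill
the line: pivot the target to the smooth class (the conjunct then needs the comparison cards).
¬BoundaryTransferWeak kills every torus
route's last step, not the mechanism. PeriodicBEC proved elsewhere moots items 0, 2, 3, 4 and the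
supports.

NOT DECOMPOSED YET. The per-mode projection identities, Parseval for γ and for u ↦ N_{Λ_u}, the
inner/outer Hölder bookkeeping of m₃'s potential part, the
sector-wise convexity argument, and the t-uniformity lemmas (E₀(tv) ≤ E₀(v), class closed under v ↦
tv) — all ride as prover lemmas with
--supports SumRuleChainGlue / LongWaveStructureBound; the transverse current (where diamagnetism is
non-trivial) is unused; T > 0,
hard cores and d = 2 are out of scope; no attempt to prove CondensateNumberConcentration via
Poincaré inequalities for Ψ₀² is filed yet.

CHEAPEST FALSIFIER. Bogoliubov insertion (done by the planner by hand; passes): R_A(k) =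
½Σ_p(2p·k+k²)²(u_pv_{p+k} − v_pu_{p+k})² = O(|k|⁴N√(ρa³)) (pair currents
cancel, exact zero at k = 0), R_ρ(k) = ½Σ_p(u_pv_{p+k} + v_pu_{p+k})² = O(N√(ρa³)), Var N̂₀ =
O(N√(ρa³)); a refuter should redo it in a
number-conserving Bogoliubov theory (terms ⟨N̂₀n̂_k⟩ − n₀n_k) and run the d = 1 sanity check (the IR
sum N√e₃Σ1/|k| must exceed N: no
conclusion in 1D, as Lieb–Liniger demands). Cheapest numerics: exact diagonalisation of N ≤ 8 soft
bosons on a small 3D torus lattice —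
check the per-mode identity/inequality n₀ + E[N̂₀(n̂_k+n̂_{−k})] + n_{−k} ≤ ½[(√m₂+√R_A)²/|k|⁴ +
(√(NS(k))+√R_ρ)²] and the size of
Var(N̂₀)/N² along t ∈ (0,1] (kit, few node-hours).

NUMBERS. IR window |k| < Λ√(ρa): mode count/N = Λ³√(ρa³)/(6π²); UV depletion ≤ KE/(Λ²ρaN)·N ≤
8πN/Λ²; e₃ = M₃/(N|k|⁴) ≤ |k|² + 48πaρ + O(ρ^{1/4});
Bogoliubov: 1 − x = (8/(3√π))√(ρa³), n_k = v_k² ≈ √(2μ̃)/(4|k|) for |k| ≪ √μ̃ (μ̃ = 8π·2ρa in units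
ħ = 2m = 1), R_A/|k|⁴ ~ R_ρ ~ Var N̂₀ ~ N√(ρa³);
LSSY2005 Thm 2.2 in tree with C = 12; Fournais box ℓ = (K√(ρa))⁻¹, K ≥ K₀(v); band threshold used in
the glue: ε₁ + ζ < 3/16.

DEFINITION REQUESTS. None needed at open: all statements are inline over
Literature.MathematicalPhysics.QuantumManyBody.BoseGas.{PeriodicTrialState, periodicEnergy,
periodicGroundStateEnergy, condensateOccupation, cell, cellN, cellWave, latticeVec, slidingBox,
scatteringLength, sideLength}. Nice to have
later (would shorten items 2–4 and 9): momentumOccupation, structureFactor, zeroModeSecondMoment,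
nonCondensateCurrent in Literature/MathematicalPhysics/QuantumManyBody.

Novelty: Searches (2026-08-15): lit search --source crossref ×6 ("condensate number fluctuations interacting
Bose gas zero temperature": GPS98
doi:10.1103/physrevlett.80.5040, Idziaszek 2005; "third moment sum rule Bose current correlation
ground state upper bound": electron-liquid
m₃ papers + energy upper bounds only; "sum rules Bose condensate depletion upper bound
Cauchy-Schwarz f-sum": Stringari 1995 chapter
doi:10.1017/cbo9780511524240.007; "Bose Einstein condensation proof continuity coupling constant
thermodynamic limit": nothing relevant;
"Gaussian domination Bose gas without reflection positivity": CorginiSankovich1999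
doi:10.1142/s0217979299002988, Corgini2003, Sankovich2013
doi:10.1016/j.physleta.2013.08.045; "pair correlation function upper bound dilute Bose gas ground
state": Isihara–Yee 1964, LHY-order
energy bounds); lit galaxy search "sum rules Bose-Einstein condensation condensate fraction bound"
--star all (0 rows); lit frontier
AtomisticToContinuum --since 2022 (22 descendants, arXiv:2510.20493, 2603.20776, 2602.04407 …, none
sum-rule based); local searchd/vsearch
unavailable this session (connection reset) — plus the two refuter novelty audits of the card
(Stringari 1995 pp. 72–77 read; Simon 1976).
Nearest prior art found: Stringari1995 (every moment inequality of the chain, used for LOWER bounds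
on n_k and the d = 1 no-go), PitaevskiiStringari1991,
KLS1988PRL (T = 0 transfer after RP), LiebSeiringerYngvason2005 (c-number substitution, pressure
only), CorginiSanko  [refs: 10.1103/physrevlett.80.5040, 10.1017/cbo9780511524240.007, 10.1142/s0217979299002988, 10.1016/j.physleta.2013.08.045, 2510.20493, doi:10.1103/physrevlett.80.5040, doi:10.1017/cbo9780511524240.007, doi:10.1142/s0217979299002988, doi:10.1016/j.physleta.2013.08.045, CorginiSankovich1999, Corgini2003, Sankovich2013, Stringari1995, PitaevskiiStringari1991, LiebSeiringerYngvason2005, GiorginiPitaevskiiS]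

Barriers (technique_class: sum-rules c-number-split coupling-bootstrap ground-state): - technique_class: sum-rules c-number-split coupling-bootstrap ground-state
- Literature.Barriers.AtomisticToContinuum.HalfFillingReflectionPositivity: no reflection positivity
anywhere; the domination step is the exact f-sum × third-moment Cauchy–Schwarz, valid in the
continuum at any filling; honest limit: it dominates the CURRENT, and reaches the order parameter
only through the split (cruxes 2, 3).
- Literature.Barriers.AtomisticToContinuum.KineticGapLengthScales: evaded by the chain (only
positive moments m₁, m₂, m₃, so k = 2π/L is harmless; UV cut by kinetic energy at Λ√(ρa), no gap at
scale L); a gap is inverted only inside the fixed-N supports (NearMinimiserStability,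
CouplingContinuity), where no uniformity in N is needed.
- Literature.Barriers.AtomisticToContinuum.EnergyAsymptoticsWithoutCondensation: evaded — only
one-sided inputs (Dyson/LSSY upper bound; Fournais' localized lower bound through convexity) enter;
no matching of asymptotics; consistent with 1D, where the chain's IR sum exceeds N and concludes
nothing.
- Literature.Barriers.AtomisticToContinuum.BogoliubovPerturbationInfrared: it does not evade it; the
bet is that the two specific summed remainders of crux 2 are small for a structural reason
(pair-current cancellation, exact at k = 0 by momentum conservation) rather than by summing a
series.
- Literature.Barriers.AtomisticToContinuum.SymmetryBreakingWithoutCondensate: evaded — canonical and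
gauge-invariant throughout, no quasi-average; the price of kee

History (route lifecycle, newest last):
- 2026-08-15T13:40:49Z · CLOSED retired — not-a-thesis: assembly does not conclude the sub-problem Statement (operator:999:1257524)

sub-problem: BoseEinsteinCondensation · status: closed(retired) · opened planner-plancard-AtomisticToContinuum-BoseEin-8d5d457b-0 2026-08-15T11:51:25Z · rev 2 · ledger route-AtomisticToContinuum-BECSumRuleBootstrap
GENERATED by the gate from the ledger (D-0016/17). Provers cite these decls: `theorem foo : Summit.AtomisticToContinuum.BoseEinsteinCondensation.Theses.BECSumRuleBootstrap.<Decl> := …` in Summits/AtomisticToContinuum/BoseEinsteinCondensation/Theorems/<Name>.lean.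
-/

namespace Summit.AtomisticToContinuum.BoseEinsteinCondensation.Theses.BECSumRuleBootstrap

open scoped BigOperators Topology Manifold Classical MeasureTheory ProbabilityTheory Matrix InnerProductSpace ComplexConjugate ContinuousMap
open Filter Set Function TopologicalSpace MeasureTheory

attribute [summit_statement] _root_.BoseEinsteinCondensation

/-- item stmt-AtomisticToContinuum-6733 · target · rank 0 · closed · moot by None · by planner
why it might fail: contains the open thermodynamic-limit BEC problem for smooth potentials (LSSY2005 Ch. 5: open; Fournais2020/Junge2026/ChongLiangNam2026 stop at L ≲ a(ρa³)^(-3/4-η)).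
sources: LSSY2005, Fournais2020, Junge2026, ChongLiangNam2026
[target] PeriodicBEC (route BECPeriodicReduction, item 0826) restricted to the smooth class: for
every repulsive finite-range v that is finite, C² as ṽ(x) = v(|x|) on ℝ³, with ‖D²ṽ(x)‖ ≤ Cₑ√ṽ(x)
(edge condition; e.g. (R₀²−|x|²)₊⁴), there is ρ₀ > 0 such that for 0 < ρ < ρ₀ there is c > 0 with:
for all large N there is δ > 0 such that every periodic trial state on the torus of side (N/ρ)^{1/3}
with periodicEnergy ≤ E₀^per + δ has constant-mode occupation ≥ cN. -/
@[route_item "route-AtomisticToContinuum-BECSumRuleBootstrap"]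
def SmoothPeriodicBEC : Prop :=
  open Literature.MathematicalPhysics.QuantumManyBody.BoseGas in ∀ v : ℝ → ENNReal, IsRepulsiveFiniteRange v → (∀ r, v r ≠ ⊤) → ContDiff ℝ 2 (fun x : Space => (v ‖x‖).toReal) → (∃ Cₑ : ℝ, ∀ x : Space, ‖iteratedFDeriv ℝ 2 (fun x : Space => (v ‖x‖).toReal) x‖ ≤ Cₑ * Real.sqrt ((v ‖x‖).toReal)) → ∃ ρ₀ : ℝ, 0 < ρ₀ ∧ ∀ ρ : ℝ, 0 < ρ → ρ < ρ₀ → ∃ c : ℝ, 0 < c ∧ ∀ᶠ N : ℕ in Filter.atTop, ∃ δ : ENNReal, 0 < δ ∧ ∀ Ψ : PeriodicTrialState N (sideLength ρ N), periodicEnergy v Ψ ≤ periodicGroundStateEnergy v N (sideLength ρ N) + δ → ENNReal.ofReal (c * N) ≤ condensateOccupation N (sideLength ρ N) Ψ.ψ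

/-- item stmt-AtomisticToContinuum-6734 · crux · rank 2 · closed · moot by None · by planner
why it might fail: 4-point functions of the depletion with no a-priori handle (Cauchy–Schwarz gives N₊·|k|²⟨T⟩, useless); smallness rests on the pair-current cancellation (u_pv_q−v_pu_q)² of Bogoliubov's state, unproved for Ψ₀ — Gavoret–Nozières territory; a log L in R_A would already break the ε.
sources: LiebSeiringerYngvason2005, Stringari1995, GavoretNozieres1964, Griffin1993, Literature.Barriers.AtomisticToContinuum.BogoliubovPerturbationInfrared
[crux] (card C1, corrected & summed) for the torus minimiser Ψ of −Σ∆ⱼ + tΣv^per (t ∈ (0,1], L =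
(N/ρ)^{1/3}, ρ < ρ₀(Λ,ε), N large): Σ over 0 < |k| < Λ√(ρa), k = 2πn/L, of ‖A_k^{nc}Ψ‖²/|k|⁴ +
‖ρ_k^{nc†}Ψ‖² is ≤ εN², where A_k^{nc} = Σⱼ Qⱼ e^{ik·xⱼ}(−2ik·∇ⱼ + |k|²) Qⱼ and ρ_k^{nc†} = Σⱼ Qⱼ
e^{ik·xⱼ} Qⱼ (Q = 1 − |φ₀⟩⟨φ₀|, written out with cell averages) are the non-condensate parts of the
longitudinal current [H,ρ_k†] and of the density. Bogoliubov: ‖A^{nc}Ψ‖² =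
½Σ_p(2p·k+k²)²(u_pv_{p+k}−v_pu_{p+k})² = O(|k|⁴N√(ρa³)), ‖ρ^{nc†}Ψ‖² = ½Σ_p(u_pv_{p+k}+v_pu_{p+k})²
= O(N√(ρa³)); summed: O(Λ³ρa³N²) — no log. [difficulty: open-problem] -/
@[route_item "route-AtomisticToContinuum-BECSumRuleBootstrap"]
def NonCondensateRemainders : Prop :=
  open Literature.MathematicalPhysics.QuantumManyBody.BoseGas in ∀ v : ℝ → ENNReal, IsRepulsiveFiniteRange v → (∀ r, v r ≠ ⊤) → ContDiff ℝ 2 (fun x : Space => (v ‖x‖).toReal) → (∃ Cₑ : ℝ, ∀ x : Space, ‖iteratedFDeriv ℝ 2 (fun x : Space => (v ‖x‖).toReal) x‖ ≤ Cₑ * Real.sqrt ((v ‖x‖).toReal)) → ∀ Λ : ℝ, 0 < Λ → ∀ ε : ℝ, 0 < ε → ∃ ρ₀ : ℝ, 0 < ρ₀ ∧ ∀ ρ : ℝ, 0 < ρ → ρ < ρ₀ → ∀ᶠ N : ℕ in Filter.atTop, ∀ t : ℝ, 0 < t → t ≤ 1 → ∀ Ψ : PeriodicTrialState N (sideLength ρ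 N), (let L : ℝ := sideLength ρ N; let w : ℝ → ENNReal := fun r => ENNReal.ofReal t * v r; periodicEnergy w Ψ = periodicGroundStateEnergy w N L → periodicEnergy w Ψ ≠ ⊤ → (∑' n : Fin 3 → ℤ, {n : Fin 3 → ℤ | n ≠ 0 ∧ ‖((2 * Real.pi / L) • latticeVec 1 n)‖ < Λ * Real.sqrt (ρ * (scatteringLength v).toReal)}.indicator (fun n => (∫⁻ X in cellN N L, (‖∑ j : Fin N, (cellWave L n (X j) * ((-2 * Complex.I) * fderiv ℝ Ψ.ψ X (Pi.single j ((2 * Real.pi / L) • latticeVec 1 n)) + (((‖((2 * Real.pi / L) • latticeVec 1 n)‖ ^ 2 : ℝ)) : ℂ) * (Ψ.ψ X - (((L ^ 3)⁻¹ : ℝ) : ℂ) * ∫ y in cell L, Ψ.ψ (Function.update X j y))) + (((‖((2 * Real.pi / L) • latticeVec 1 n)‖ ^ 2 : ℝ)) : ℂ) * ((((L ^ 3)⁻¹ : ℝ) : ℂ) * ∫ y in cell L, cellWave L n y * Ψ.ψ (Function.update X j y)))‖₊ : ENNReal) ^ 2) / ENNReal.ofReal (‖((2 * Real.pi / L) •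 latticeVec 1 n)‖ ^ 4) + (∫⁻ X in cellN N L, (‖∑ j : Fin N, (cellWave L n (X j) * (Ψ.ψ X - (((L ^ 3)⁻¹ : ℝ) : ℂ) * ∫ y in cell L, Ψ.ψ (Function.update X j y)) - (((L ^ 3)⁻¹ : ℝ) : ℂ) * ∫ y in cell L, cellWave L n y * Ψ.ψ (Function.update X j y))‖₊ : ENNReal) ^ 2)) n) ≤ ENNReal.ofReal (ε * (N : ℝ) ^ 2))

/-- item stmt-AtomisticToContinuum-6735 · crux · rank 3 · closed · moot by None · by planner
why it might fail: equivalent to excluding a macroscopic superposition of a condensed and an uncondensed branch, i.e. a first-order transition at some t* ≤ 1 at finite N; reducible to m₁(N̂₀) = ½⟨[N̂₀,[V,N̂₀]]⟩ = O(Nρa) plus a P=0-sector gap ≫ a/L³, and no N-uniform many-body gap bound is known.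
sources: doi:10.1103/physrevlett.80.5040, LiebSeiringerYngvason2005, LSSY2005, Literature.Barriers.AtomisticToContinuum.SymmetryBreakingWithoutCondensate
[crux] (planner's addition; the card's bootstrap needs it) along the coupling path the zero-mode
number operator N̂₀ = ΣⱼPⱼ of the torus minimiser satisfies E[N̂₀²] = N(N−1)‖P₁P₂Ψ‖² + n₀ ≤ n₀² +
ζN² for N large, every ζ > 0, ρ < ρ₀(ζ), uniformly in t ∈ (0,1]: Var(N̂₀/N) → 0. With the chain's
dichotomy E[N̂₀(N−N̂₀)] ≤ εN² this gives x(1−x) ≤ ε + ζ for the mean x = n₀/N. Bogoliubov: Var N̂₀ =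
Σ_k 2u_k²v_k² = O(N√(ρa³)). [difficulty: XL] -/
@[route_item "route-AtomisticToContinuum-BECSumRuleBootstrap"]
def CondensateNumberConcentration : Prop :=
  open Literature.MathematicalPhysics.QuantumManyBody.BoseGas in ∀ v : ℝ → ENNReal, IsRepulsiveFiniteRange v → (∀ r, v r ≠ ⊤) → ContDiff ℝ 2 (fun x : Space => (v ‖x‖).toReal) → (∃ Cₑ : ℝ, ∀ x : Space, ‖iteratedFDeriv ℝ 2 (fun x : Space => (v ‖x‖).toReal) x‖ ≤ Cₑ * Real.sqrt ((v ‖x‖).toReal)) → ∀ ζ : ℝ, 0 < ζ → ∃ ρ₀ : ℝ, 0 < ρ₀ ∧ ∀ ρ : ℝ, 0 < ρ → ρ < ρ₀ → ∀ᶠ n : ℕ in Filter.atTop, ∀ t : ℝ, 0 < t → t ≤ 1 → ∀ Ψ : PeriodicTrialState (n + 2) (sideLength ρ (n + 2)), (let L : ℝ := sideLength ρ (n + 2); let w : ℝ → ENNReal := fun r => ENNReal.ofReal t * v r; periodicEnergy w Ψ = periodicGroundStateEnergy w (n + 2) L → periodicEnergy w Ψ ≠ ⊤ → ((n + 2 :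 ℕ) : ENNReal) * ((n + 1 : ℕ) : ENNReal) * (∫⁻ Y in cellN n L, (‖∫ x in cell L, ∫ y in cell L, Ψ.ψ (Matrix.vecCons x (Matrix.vecCons y Y))‖₊ : ENNReal) ^ 2) / ENNReal.ofReal (L ^ 6) + condensateOccupation (n + 2) L Ψ.ψ ≤ condensateOccupation (n + 2) L Ψ.ψ ^ 2 + ENNReal.ofReal (ζ * ((n : ℝ) + 2) ^ 2))

/-- item stmt-AtomisticToContinuum-6736 · crux · rank 4 · closed · moot by None · by planner
why it might fail: meant to follow from convexity: Fournais2020 Thm 2.1 (proved) used sector-wise with box-wise chemical potential on a K-grid vs Dyson's upper bound; if C₀(K), c(K) are not uniform on the grid or the flat-top χ boundary layer leaks, it needs an LHY-precision upper bound.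
sources: Fournais2020, BrietzkeFournaisSolovej2020, LSSY2005, YauYin2009, BastiCenatiempoSchlein2021
[crux] long-wave number fluctuations of the torus minimiser are relatively small: with ℓ =
(K√(ρa))⁻¹ and sliding boxes Λ_u(ℓ) (periodised), L⁻³∫_cell E_Ψ[N_{Λ_u}²] du ≤ (1+ε)(ρℓ³)² for N
large, every K, ε > 0, ρ < ρ₀(K,ε), uniformly in t. By Parseval in u it gives Σ_{0<|k|<πK√(ρa)} S(k)
≤ (π/2)⁶εN (all the static-structure input the chain needs: mode count ≪ N) and the close-pair
counts entering m₃. [difficulty: L] -/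
@[route_item "route-AtomisticToContinuum-BECSumRuleBootstrap"]
def LongWaveStructureBound : Prop :=
  open Literature.MathematicalPhysics.QuantumManyBody.BoseGas in ∀ v : ℝ → ENNReal, IsRepulsiveFiniteRange v → (∀ r, v r ≠ ⊤) → ContDiff ℝ 2 (fun x : Space => (v ‖x‖).toReal) → (∃ Cₑ : ℝ, ∀ x : Space, ‖iteratedFDeriv ℝ 2 (fun x : Space => (v ‖x‖).toReal) x‖ ≤ Cₑ * Real.sqrt ((v ‖x‖).toReal)) → ∀ K : ℝ, 0 < K → ∀ ε : ℝ, 0 < ε → ∃ ρ₀ : ℝ, 0 < ρ₀ ∧ ∀ ρ : ℝ, 0 < ρ → ρ < ρ₀ → ∀ᶠ N : ℕ in Filter.atTop, ∀ t : ℝ, 0 < t → t ≤ 1 → ∀ Ψ : PeriodicTrialState N (sideLength ρ N), (let L : ℝ := sideLength ρ N; let w : ℝ → ENNReal := fun r => ENNReal.ofReal t * v r; periodicEnergy w Ψ = periodicGroundStateEnergy w N L → periodicEnergy w Ψ ≠ ⊤ → (let ℓ : ℝ := (K * Real.sqrt (ρ * (scatteringLength v).toReal))⁻¹; (∫⁻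 u in cell L, ∫⁻ X in cellN N L, (∑ j : Fin N, ∑' m : Fin 3 → ℤ, (slidingBox ℓ u).indicator (fun _ => (1 : ENNReal)) (X j + latticeVec L m)) ^ 2 * (‖Ψ.ψ X‖₊ : ENNReal) ^ 2) ≤ ENNReal.ofReal ((1 + ε) * (ρ * ℓ ^ 3) ^ 2 * L ^ 3)))

/-- item stmt-AtomisticToContinuum-0827 · crux · rank 5 · open · by planner
why it might fail: PeriodicBEC(v) is ground-state-only (δ after N); the Dirichlet GS is a periodic trial state but lies a wall term ≫ δ above E₀^per, so no energy-comparison proof; only the ENERGY transfer is in print; BEC can be boundary-condition sensitive.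
sources: LSSY2005, arXiv:2203.01841, arXiv:2205.15284, doi:10.1007/bf01608554
[crux] BoundaryTransferWeak (mode-free boundary-condition transfer, per potential): for each
repulsive finite-range v, PeriodicBEC(v) implies ∃ρ₀>0 ∀ρ∈(0,ρ₀) HasGroundStateBEC v ρ (Dirichlet
ground state, λ_max(γ) ≥ cN via condensateNumber). Not glue: near-minimiser slacks are O(N/L²) while
Dirichlet/periodic energies differ by a boundary term ≫ N/L², so no energy-comparison proof;
expected route: Neumann bracketing of interior sub-boxes (−Δ_Dir ≥ ⊕−Δ_Neu, v ≥ 0) + a mode-free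
criterion (λ_max ≥ tr γ²/N). Only the ENERGY analogue is in print (LiebSeiringerSolovejYngvason2005
Ch. 2 after (2.8)). v ≡ 0: hypothesis and conclusion both true. -/
@[route_item "route-AtomisticToContinuum-BECSumRuleBootstrap"]
def BoundaryTransferWeak : Prop :=
  ∀ v : ℝ → ENNReal, Literature.MathematicalPhysics.QuantumManyBody.BoseGas.IsRepulsiveFiniteRange v → (∃ ρ₀ : ℝ, 0 < ρ₀ ∧ ∀ ρ : ℝ, 0 < ρ → ρ < ρ₀ → ∃ c : ℝ, 0 < c ∧ ∀ᶠ N : ℕ in Filter.atTop, ∃ δ : ENNReal, 0 < δ ∧ ∀ Ψ : Literature.MathematicalPhysics.QuantumManyBody.BoseGas.PeriodicTrialState N (Literature.MathematicalPhysics.QuantumManyBody.BoseGas.sideLength ρ N), Literature.MathematicalPhysics.QuantumManyBody.BoseGas.periodicEnergy v Ψ ≤ Literature.MathematicalPhysics.QuantumManyBody.BoseGas.periodicGroundStateEnergy v N (Literature.MathematicalPhysics.QuantumManyBody.BoseGas.sideLength ρ N) + δ → ENNReal.ofReal (c * N) ≤ Literature.MathematicalPhysics.QuantumManyBody.BoseGas.condensateOccupation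 N (Literature.MathematicalPhysics.QuantumManyBody.BoseGas.sideLength ρ N) Ψ.ψ) → ∃ ρ₀ : ℝ, 0 < ρ₀ ∧ ∀ ρ : ℝ, 0 < ρ → ρ < ρ₀ → Literature.MathematicalPhysics.QuantumManyBody.BoseGas.HasGroundStateBEC v ρ

/-- item stmt-AtomisticToContinuum-6737 · crux · rank 6 · closed · moot by None · by planner
why it might fail: no comparison or monotonicity of λ_max(γ) in v is known; approximating a hard core by class members v_n ↑ gives BEC with ρ₀(v_n), c(v_n) possibly → 0; Dyson's lemma transfers energies only (small-N numerics of cards repulsion-monotone-hard-sphere support antitonicity of γ_v, unproved).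
sources: LSSY2005, Dyson1957, LiebYngvason1998
[crux] ground-state BEC at all small densities for every potential of the smooth class (finite, C²,
finite range, ‖D²ṽ‖ ≤ Cₑ√ṽ) implies the conjunct for every repulsive finite-range potential (hard
cores, shells, kinks included). [difficulty: XL] -/
@[route_item "route-AtomisticToContinuum-BECSumRuleBootstrap"]
def HardCoreExtension : Prop :=
  open Literature.MathematicalPhysics.QuantumManyBody.BoseGas in (∀ v : ℝ → ENNReal, IsRepulsiveFiniteRange v → (∀ r, v r ≠ ⊤) → ContDiff ℝ 2 (fun x : Space => (v ‖x‖).toReal) → (∃ Cₑ : ℝ, ∀ x : Space, ‖iteratedFDeriv ℝ 2 (fun x : Space => (v ‖x‖).toReal) x‖ ≤ Cₑ * Real.sqrt ((v ‖x‖).toReal)) → ∃ ρ₀ : ℝ, 0 < ρ₀ ∧ ∀ ρ : ℝ, 0 < ρ → ρ < ρ₀ → HasGroundStateBEC v ρ) → Literature.MathematicalPhysics.QuantumManyBody.BoseGas.BoseEinsteinCondensation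

/-- item stmt-AtomisticToContinuum-6738 · support · rank 9 · closed · moot by None · by planner
sources: Puff1965, Wagner1966, Stringari1995, PitaevskiiStringari1991, KLS1988PRL
[support] (the engine; Puff/Wagner/Stringari moments, variational form) for t ∈ (0,1], 2R₀ < L and
every C³ periodic minimiser Ψ of −Σ∆ + tΣv^per with finite energy, for every k = 2πn/L ≠ 0: m₂² ≤
m₁·M₃ with m₂ = ‖Σⱼe^{ik·xⱼ}(−2ik·∇ⱼ+|k|²)Ψ‖² (= ‖[H,ρ_k†]Ψ‖²), m₁ = N|k|² (f-sum) and M₃ =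
12|k|²Σⱼ‖(k·∇ⱼ)Ψ‖² + N|k|⁶ + 4E_Ψ[Σ_{i<j}(1−cos k·(xᵢ−xⱼ))|(k·∇)²(tṽ^per)(xᵢ−xⱼ)|] ≥ m₃ =
½⟨[A_k†,[H,A_k]]⟩. Proof: 0 ≤ q_{H−E₀}(sA_kΨ − ρ_k†Ψ) = s²m₃ − 2sm₂ + m₁ for all s > 0, using only
the weak Euler–Lagrange equation of the minimiser, inversion symmetry k ↔ −k and integration by
parts — no spectral theorem. [difficulty: M] -/
@[route_item "route-AtomisticToContinuum-BECSumRuleBootstrap"]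
def CurrentSumRule : Prop :=
  open Literature.MathematicalPhysics.QuantumManyBody.BoseGas in ∀ v : ℝ → ENNReal, IsRepulsiveFiniteRange v → (∀ r, v r ≠ ⊤) → ContDiff ℝ 2 (fun x : Space => (v ‖x‖).toReal) → (∃ Cₑ : ℝ, ∀ x : Space, ‖iteratedFDeriv ℝ 2 (fun x : Space => (v ‖x‖).toReal) x‖ ≤ Cₑ * Real.sqrt ((v ‖x‖).toReal)) → ∀ R₀ : ℝ, 0 < R₀ → (∀ r, R₀ < r → v r = 0) → ∀ t : ℝ, 0 < t → t ≤ 1 → ∀ N : ℕ, ∀ L : ℝ, 2 * R₀ < L → ∀ Ψ : PeriodicTrialState N L, ContDiff ℝ 3 Ψ.ψ → (let w : ℝ → ENNReal := fun r => ENNReal.ofReal t * v r; periodicEnergy w Ψ = periodicGroundStateEnergy w N L → periodicEnergy w Ψ ≠ ⊤ → ∀ n : Fin 3 → ℤ, n ≠ 0 → (∫⁻ X in cellN N L, (‖∑ j : Fin N, cellWave L n (X j) * ((-2 * Complex.I) * fderiv ℝ Ψ.ψ X (Pi.single j ((2 * Real.pi / L) • latticeVec 1 n)) + (((‖((2 *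 Real.pi / L) • latticeVec 1 n)‖ ^ 2 : ℝ)) : ℂ) * Ψ.ψ X)‖₊ : ENNReal) ^ 2) ^ 2 ≤ ENNReal.ofReal ((N : ℝ) * ‖((2 * Real.pi / L) • latticeVec 1 n)‖ ^ 2) * (ENNReal.ofReal (12 * ‖((2 * Real.pi / L) • latticeVec 1 n)‖ ^ 2) * (∑ j : Fin N, ∫⁻ X in cellN N L, (‖fderiv ℝ Ψ.ψ X (Pi.single j ((2 * Real.pi / L) • latticeVec 1 n))‖₊ : ENNReal) ^ 2) + ENNReal.ofReal ((N : ℝ) * ‖((2 * Real.pi / L) • latticeVec 1 n)‖ ^ 6) + 4 * ∫⁻ X in cellN N L, (∑ i : Fin N, ∑ j : Fin N with i < j, ENNReal.ofReal ((1 - Real.cos (inner ℝ ((2 * Real.pi / L) • latticeVec 1 n) (X i - X j))) * |fderiv ℝ (fun z : Space => fderiv ℝ (fun z : Space => ∑' m : Fin 3 → ℤ, t * (v ‖z - latticeVec L m‖).toReal) z ((2 * Real.pi / L) • latticeVec 1 n)) (X i - X j) ((2 * Real.pi / L) • latticeVec 1 n)|)) * (‖Ψ.ψ X‖₊ : ENNReal)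 ^ 2))

/-- item stmt-AtomisticToContinuum-6739 · support · rank 9 · closed · moot by None · by planner
sources: ReedSimonIV1978, LSSY2005
[support] for every class potential, N ≥ 1 and L > 0 the periodic N-body energy has a minimiser in
the C¹ periodic Bose-symmetric class which is C³ with finite energy (Rellich on the torus, elliptic
regularity C^{3,α} for V ∈ C², bosonic ground state = absolute ground state, Perron–Frobenius
positivity). [difficulty: L] -/
@[route_item "route-AtomisticToContinuum-BECSumRuleBootstrap"]
def MinimiserRegularity : Prop :=
  open Literature.MathematicalPhysics.QuantumManyBody.BoseGas in ∀ v : ℝ → ENNReal, IsRepulsiveFiniteRange v → (∀ r, v r ≠ ⊤) → ContDiff ℝ 2 (fun x : Space => (v ‖x‖).toReal) → (∃ Cₑ : ℝ, ∀ x : Space, ‖iteratedFDeriv ℝ 2 (fun x : Space => (v ‖x‖).toReal) x‖ ≤ Cₑ * Real.sqrt ((v ‖x‖).toReal)) → ∀ N : ℕ, 0 < N → ∀ L : ℝ, 0 < L → ∃ Ψ : PeriodicTrialState N L, periodicEnergy v Ψ = periodicGroundStateEnergy v N L ∧ periodicEnergy v Ψ ≠ ⊤ ∧ ContDiff ℝ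 3 Ψ.ψ

/-- item stmt-AtomisticToContinuum-6740 · support · rank 9 · closed · moot by None · by planner
sources: ReedSimonIV1978, LSSY2005
[support] at fixed N, L: for every ε > 0 there is δ > 0 such that every δ-near-minimiser Φ has
condensateOccupation ≥ that of a minimiser Ψ minus εN (discrete spectrum and simple ground state by
positivity improvement: ‖Φ − e^{iθ}Ψ‖² ≤ δ/gap; n₀ is 2N-Lipschitz in L²). [difficulty: M] -/
@[route_item "route-AtomisticToContinuum-BECSumRuleBootstrap"]
def NearMinimiserStability : Prop :=
  open Literature.MathematicalPhysics.QuantumManyBody.BoseGas in ∀ v : ℝ → ENNReal, IsRepulsiveFiniteRange v → (∀ r, v r ≠ ⊤) → ContDiff ℝ 2 (fun x : Space => (v ‖x‖).toReal) → (∃ Cₑ : ℝ, ∀ x : Space, ‖iteratedFDeriv ℝ 2 (fun x : Space => (v ‖x‖).toReal) x‖ ≤ Cₑ * Real.sqrt ((v ‖x‖).toReal)) → ∀ N : ℕ, ∀ L : ℝ, 0 < L → periodicGroundStateEnergy v N L ≠ ⊤ → ∀ ε : ℝ, 0 < ε → ∃ δ : ENNReal, 0 < δ ∧ ∀ Ψ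 Φ : PeriodicTrialState N L, periodicEnergy v Ψ = periodicGroundStateEnergy v N L → periodicEnergy v Φ ≤ periodicGroundStateEnergy v N L + δ → condensateOccupation N L Ψ.ψ ≤ condensateOccupation N L Φ.ψ + ENNReal.ofReal (ε * N)

/-- item stmt-AtomisticToContinuum-6741 · support · rank 9 · closed · moot by None · by planner
sources: Kato1966, ReedSimonIV1978
[support] at fixed N, L the constant-mode occupation of the minimiser of −Σ∆ + tΣv^per is uniformly
continuous in t ∈ [0,1] (including: two minimisers at the same t have the same n₀; at t = 0 the
minimisers are the constants, n₀ = N): analytic perturbation theory of a simple isolated eigenvalue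
(free torus gap (2π/L)², Perron–Frobenius for t > 0). [difficulty: L] -/
@[route_item "route-AtomisticToContinuum-BECSumRuleBootstrap"]
def CouplingContinuity : Prop :=
  open Literature.MathematicalPhysics.QuantumManyBody.BoseGas in ∀ v : ℝ → ENNReal, IsRepulsiveFiniteRange v → (∀ r, v r ≠ ⊤) → ContDiff ℝ 2 (fun x : Space => (v ‖x‖).toReal) → (∃ Cₑ : ℝ, ∀ x : Space, ‖iteratedFDeriv ℝ 2 (fun x : Space => (v ‖x‖).toReal) x‖ ≤ Cₑ * Real.sqrt ((v ‖x‖).toReal)) → ∀ N : ℕ, ∀ L : ℝ, 0 < L → ∀ ε : ℝ, 0 < ε → ∃ δ : ℝ, 0 < δ ∧ ∀ t t' : ℝ, 0 ≤ t → t ≤ 1 → 0 ≤ t' → t' ≤ 1 → |t - t'| < δ → ∀ Ψ Ψ' : PeriodicTrialState N L, (let w : ℝ → ENNReal := fun r => ENNReal.ofReal t * v r; let w' : ℝ → ENNReal := fun r => ENNReal.ofReal t' * v r; periodicEnergy w Ψ = periodicGroundStateEnergy w N L → periodicEnergy w Ψ ≠ ⊤ → periodicEnergy w' Ψ' = periodicGroundStateEnergy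 w' N L → periodicEnergy w' Ψ' ≠ ⊤ → condensateOccupation N L Ψ.ψ ≤ condensateOccupation N L Ψ'.ψ + ENNReal.ofReal (ε * N))

/-- item stmt-AtomisticToContinuum-6742 · support · rank 9 · closed · moot by None · by planner
sources: Stringari1995, LSSY2005, Fournais2020, LiebSeiringerYngvason2005
[support] (glue of the foreseen split; kind glue) MinimiserRegularity → CouplingContinuity →
NearMinimiserStability → CurrentSumRule → LongWaveStructureBound → NonCondensateRemainders →
CondensateNumberConcentration → SmoothPeriodicBEC. Bookkeeping: (i) per-mode identity ‖A_k^cΨ‖²/|k|⁴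
+ ‖ρ_k^{c†}Ψ‖² = 2n₀ + 2E[N̂₀(n̂_k+n̂_{−k})] + 2n_{−k} and ‖A^c‖ ≤ ‖A‖ + ‖A^{nc}‖; (ii) m₂ ≤
√(N|k|²M₃), M₃ ≤ N|k|⁴(|k|² + 48πaρ + o(1)) from Σ‖(k·∇ⱼ)Ψ‖² ≤ |k|²KE ≤ |k|²E₀(tv) ≤ |k|²E₀(v) ≤
|k|²·8πaρN (LSSY2005_upperBound_periodic_holds) and, for the potential part, ‖D²ṽ‖ ≤ Cₑ√ṽ + Hölder +
close-pair counts from LongWaveStructureBound (O(ρ^{1/4})); (iii) Σ_{IR}S(k) ≤ (π/2)⁶εN (Parseval in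
u, K = Λ/π), mode count ≤ Λ³√(ρa³)N/(6π²); (iv) UV: Σ_{|k|≥Λ√(ρa)} n_k ≤ KE/(Λ²ρa) ≤ 8πN/Λ²
(Parseval for γ with the in-tree cell Fourier toolkit); (v) ⇒ E[N̂₀(N−N̂₀)] ≤ ε₁N², with crux 3
x(1−x) ≤ ε₁ + ζ < 3/16 ⇒ x ∉ (1/4,3/4) for all t; CouplingContinuity, x(0) = 1 and connectedness of
[0,1] ⇒ x(1) ≥ 3/4; NearMinimiserStability with ε = 1/4 ⇒ c = 1/2. Degenerate a = 0:
LSSY2005_zeroScatteringLength_holds ⇒ minimiser constant. [difficulty: L] -/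
@[route_item "route-AtomisticToContinuum-BECSumRuleBootstrap"]
def SumRuleChainGlue : Prop :=
  MinimiserRegularity → CouplingContinuity → NearMinimiserStability → CurrentSumRule → LongWaveStructureBound → NonCondensateRemainders → CondensateNumberConcentration → SmoothPeriodicBEC

/-- item stmt-AtomisticToContinuum-6743 · assembly · rank 1 · closed · moot by None · by planner
sources: LSSY2005, Stringari1995
[assembly] NonCondensateRemainders → CondensateNumberConcentration → LongWaveStructureBound →
CurrentSumRule → MinimiserRegularity → CouplingContinuity → NearMinimiserStability →
SumRuleChainGlue → BoundaryTransferWeak → HardCoreExtension → BoseEinsteinCondensation (term: fun h2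
h3 h4 hS hM hC hN hG hB hH => hH (fun v a b c d => hB v a (hG hM hC hN hS h4 h2 h3 v a b c d))). -/
@[route_item "route-AtomisticToContinuum-BECSumRuleBootstrap"]
def Assembly : Prop :=
  NonCondensateRemainders → CondensateNumberConcentration → LongWaveStructureBound → CurrentSumRule → MinimiserRegularity → CouplingContinuity → NearMinimiserStability → SumRuleChainGlue → BoundaryTransferWeak → HardCoreExtension → Literature.MathematicalPhysics.QuantumManyBody.BoseGas.BoseEinsteinCondensation

end Summit.AtomisticToContinuum.BoseEinsteinCondensation.Theses.BECSumRuleBootstrap
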